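import Summits.BirchSwinnertonDyer.BirchSwinnertonDyer.Theorems.ManinLocalTwoThreeColumnRelationsNinetySix
import Summits.BirchSwinnertonDyer.BirchSwinnertonDyer.Theorems.ManinLocalTwoThreeCurveExclusionNinetySix
import Summits.BirchSwinnertonDyer.BirchSwinnertonDyer.Theorems.ManinLocalTwoThreeOldFormsNinetySix
import Summits.BirchSwinnertonDyer.BirchSwinnertonDyer.Theorems.ManinLocalTwoThreeManinConstantNinetySix
import Summits.BirchSwinnertonDyer.BirchSwinnertonDyer.Theorems.ManinLocalTwoThreeNewformPinningFortyFourOfTable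
import Literature.NumberTheory.EllipticCurves.CuspFormLFunctionLevelConductorProofs
import HarnessLib

/-!
# LEVEL `96 = 2⁵·3` COMPLETE: the newform of every `X₀(96)`-datum is `φ₉₆ₐ` or `φ₉₆_b` (FACT-FREE PINNING), hence `|c| = 1`, `2 ∤ c`, `3 ∤ c`
# for EVERY lattice-optimal `X₀(96)`-datum — UNCONDITIONALLY

Cell `bsd-f2-manin`, route `ManinLocalTwoThree`, crux C2 `ManinOddAtFour` (stmt-BirchSwinnertonDyer-22967, `2² ∣ 96`; `v₂(96) = 5`, the charter's
«no semistable partner» cell; genus `9`, two classes `96a`, `96b`), prover seat p1 gen 25; `--supports stmt-BirchSwinnertonDyer-22967` (helper).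
The assembly of the level-`96` newform pinning (an g51 MEMO-an §96, `S₂`-variant; p1 g25 files `…EtaCuspBasisNinetySix`, `…BasisNinetySix`,
`…BasisSolveNinetySix`, `…ColumnRelationsNinetySix`, `…CurveExclusionNinetySix`, `…OldFormsNinetySix`) and of p3 g24's two class squeezes
(`…ManinConstantNinetySix.maninConstant_ninetySix_of_pinning`, hypothesis `hpin`).  For every elliptic `W/ℚ` and every `D : ModularParametrizationData W 96`:

* `curveInputs_ninetySix` : `a₂(W) = 0` (newness, `2² ∣ 96`), `2 ∣ N_W`, `3 ∣ N_W`; hence `a₄ = a₆ = 0`, `a₉ = a₃²`;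
* `coeffs_cases_ninetySix` : the five column relations of `S₂(Γ₀(96))` on `D.f` feed `coeffVector_ninetySix`: `(a₃, a₅, a₇, a₁₁)` is
  `96a`'s `(1, 2, −4, 4)`, `96b`'s `(−1, 2, 4, −4)`, or an old vector `(1, −2, 0, −4)` (`48a`), `(−1, −2, 0, 4)` (`24a`);
* `coeffs_eq_ninetySix` : the two old vectors die on `oldWitness96_48a`, `oldWitness96_24a` (`old ⊓ new = ⊥`, pivots separate);
* **`f_eq_ninetySix`** : `D.f = B₂c + B₃c + B₄c + 2B₅c ∨ D.f = 4B₁c − B₂c + B₃c + B₄c + 2B₅c` on the basis, and **`f_apply_eq_ninetySix`** : the same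
  AS FUNCTIONS — literally p3's `hpin`;
* **`abs_maninConstant_eq_one_ninetySix`**, **`not_two_dvd_maninConstant_ninetySix`**, `not_three_dvd_maninConstant_ninetySix`,
  `not_prime_dvd_maninConstant_ninetySix`, `maninConstant_ninetySix` (p3's package with `hpin` DISCHARGED), and the C2 shape restricted to
  `N = 96` with its printed-fact binders unused (`maninOddAtFour_ninetySix`).

HONEST FRAMING: unconditional (standard axioms): Manin's conjecture on the `X₀(96)`-domain of the tree's rendering.  The `∀ N` crux C2,
Manin's conjecture in general and BSD are NOT proved; item 22967 stays OPEN as filed (⟸ CDT).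
[cite: AtkinLehner1970, Thm. 3, Thm. 5] [cite: DiamondShurman2005, §5.8, §8.8 (8.44)] [cite: AgasheRibetStein2006, §§1–2]
[cite: CremonaAlgorithms1997, Table 3 (N = 96)]
-/

set_option autoImplicit false
-- lint-debt: the directory name repeats the summit name (sibling precedent `ManinLocalTwoThreeNewformPinningOneHundredEight.lean`)
set_option linter.dupNamespace false

noncomputable section

open Complex
open UpperHalfPlane hiding I
open scoped MatrixGroups ModularForm
open CongruenceSubgroup PowerSeries WeierstrassCurve
open Literature.NumberTheory.ModularForms
open Literature.NumberTheory.EllipticCurves Literature.NumberTheory.EllipticCurves.ModularForms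

namespace Summit.BirchSwinnertonDyer.BirchSwinnertonDyer.Theorems.ManinLocalTwoThree.LevelNinetySix

variable {W : WeierstrassCurve ℚ} [W.IsElliptic]

/-! ## §1 The curve side of an `X₀(96)`-datum -/

omit [W.IsElliptic] in
/-- The coefficients of `D.f` are the curve's `aₙ`. [folklore] -/
theorem cuspCoeff_f96 (D : ModularParametrizationData W 96) (n : ℕ) : cuspCoeff D.f n = (W.LFunction n : ℂ) :=
  D.isNewformOf.2 n

/-- **Curve-side inputs at `96`**: `a₂(W) = 0` (newness, `2² ∣ 96`), `2 ∣ N_W`, `3 ∣ N_W`. [cite: AtkinLehner1970, Thm. 3] [cite: DiamondShurman2005, §5.8] -/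
theorem curveInputs_ninetySix (D : ModularParametrizationData W 96) :
    W.LFunction 2 = 0 ∧ 2 ∣ W.conductorNorm ℤ ∧ 3 ∣ W.conductorNorm ℤ := by
  refine ⟨?_, (D.isNewformOf.dvd_level_iff_dvd_conductorNorm Nat.prime_two).mp ⟨48, by norm_num⟩,
    (D.isNewformOf.dvd_level_iff_dvd_conductorNorm Nat.prime_three).mp ⟨32, by norm_num⟩⟩
  have h0 := cuspCoeff_eq_zero_of_sq_dvd_of_mem_newSubspace0 D.isNewformOf.1.1 Nat.prime_two ⟨24, by norm_num⟩
  rw [D.isNewformOf.2 2] at h0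
  exact_mod_cast h0

/-- **The forced pivots**: `a₄(W) = a₆(W) = 0` and `a₉(W) = a₃(W)²`. [cite: DiamondShurman2005, §8.8 (8.44)] -/
theorem forcedPivots_ninetySix (D : ModularParametrizationData W 96) :
    W.LFunction 4 = 0 ∧ W.LFunction 6 = 0 ∧ W.LFunction 9 = W.LFunction 3 * W.LFunction 3 := by
  obtain ⟨h2, h2N, h3N⟩ := curveInputs_ninetySix D
  have r4 := LevelFortyFour.lFunction_four W
  have r9 := LevelFortyFour.lFunction_nine W
  have m6 : W.LFunction 6 = W.LFunction 2 * W.LFunction 3 := LevelFortyFour.lFunction_mul W (m := 2) (n := 3) (by norm_num)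
  rw [if_pos h2N] at r4
  rw [if_pos h3N, sub_zero] at r9
  exact ⟨by rw [r4, h2]; ring, by rw [m6, h2]; ring, r9⟩

/-! ## §2 The four cases and the exclusion of the two old ones -/

/-- **The four cases** for `(a₃, a₅, a₇, a₁₁)(W)`: the column relations of `S₂(Γ₀(96))` on `D.f` + the curve-side exclusion.
[cite: DiamondShurman2005, §8.8 (8.44)] [cite: CremonaAlgorithms1997, Table 3 (N = 96)] -/
theorem coeffs_cases_ninetySix (D : ModularParametrizationData W 96) :
    (W.LFunction 3 = 1 ∧ W.LFunction 5 = 2 ∧ W.LFunction 7 = -4 ∧ W.LFunction 11 = 4) ∨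
      (W.LFunction 3 = -1 ∧ W.LFunction 5 = 2 ∧ W.LFunction 7 = 4 ∧ W.LFunction 11 = -4) ∨
      (W.LFunction 3 = 1 ∧ W.LFunction 5 = -2 ∧ W.LFunction 7 = 0 ∧ W.LFunction 11 = -4) ∨
      (W.LFunction 3 = -1 ∧ W.LFunction 5 = -2 ∧ W.LFunction 7 = 0 ∧ W.LFunction 11 = 4) := by
  obtain ⟨-, -, h3N⟩ := curveInputs_ninetySix D
  obtain ⟨h13, h15, h25, h33, h35⟩ := columnRelations_ninetySix D.f
  simp only [cuspCoeff_f96 D] at h13 h15 h25 h33 h35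
  exact coeffVector_ninetySix W h3N (by exact_mod_cast h13) (by exact_mod_cast h15) (by exact_mod_cast h25)
    (by exact_mod_cast h33) (by exact_mod_cast h35)

omit [W.IsElliptic] in
/-- **An old form with the nine pivot coefficients of `D.f` contradicts newness** (`old ⊓ new = ⊥` and the pivots separate `S₂(Γ₀(96))`).
[cite: AtkinLehner1970, Thm. 5] -/
theorem false_of_oldWitness_ninetySix (D : ModularParametrizationData W 96) (G : CuspForm (Gamma0 96) 2)
    (hG : G ∈ oldSubspace0 96 2)
    (g1 : cuspCoeff G 1 = (W.LFunction 1 : ℂ)) (g2 : cuspCoeff G 2 = (W.LFunction 2 : ℂ)) (g3 : cuspCoeff G 3 = (W.LFunction 3 : ℂ))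
    (g4 : cuspCoeff G 4 = (W.LFunction 4 : ℂ)) (g5 : cuspCoeff G 5 = (W.LFunction 5 : ℂ)) (g6 : cuspCoeff G 6 = (W.LFunction 6 : ℂ))
    (g7 : cuspCoeff G 7 = (W.LFunction 7 : ℂ)) (g9 : cuspCoeff G 9 = (W.LFunction 9 : ℂ))
    (g11 : cuspCoeff G 11 = (W.LFunction 11 : ℂ)) : False := by
  apply LevelFortyFour.not_mem_oldSubspace0_of_isNewform0 D.isNewformOf.1
  have hDG : D.f = G := pivotsSeparate_ninetySix D.f G (by rw [cuspCoeff_f96, g1]) (by rw [cuspCoeff_f96, g2])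
    (by rw [cuspCoeff_f96, g3]) (by rw [cuspCoeff_f96, g4]) (by rw [cuspCoeff_f96, g5]) (by rw [cuspCoeff_f96, g6])
    (by rw [cuspCoeff_f96, g7]) (by rw [cuspCoeff_f96, g9]) (by rw [cuspCoeff_f96, g11])
  rw [hDG]
  exact hG

/-- **`(a₃, a₅, a₇, a₁₁)(W) ∈ {(1, 2, −4, 4), (−1, 2, 4, −4)}` for every elliptic `W/ℚ` carrying an `X₀(96)`-datum** — FACT-FREE: the two old
cases die on `oldWitness96_48a`, `oldWitness96_24a`. [cite: AtkinLehner1970, Thm. 5] [cite: CremonaAlgorithms1997, Table 3 (N = 96)] -/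
theorem coeffs_eq_ninetySix (D : ModularParametrizationData W 96) :
    (W.LFunction 3 = 1 ∧ W.LFunction 5 = 2 ∧ W.LFunction 7 = -4 ∧ W.LFunction 11 = 4) ∨
      (W.LFunction 3 = -1 ∧ W.LFunction 5 = 2 ∧ W.LFunction 7 = 4 ∧ W.LFunction 11 = -4) := by
  obtain ⟨h2, -, -⟩ := curveInputs_ninetySix D
  obtain ⟨h4, h6, h9⟩ := forcedPivots_ninetySix D
  have hL1 : W.LFunction 1 = 1 := W.LFunction_apply_one
  rcases coeffs_cases_ninetySix D with h | h | ⟨h3, h5, h7, h11⟩ | ⟨h3, h5, h7, h11⟩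
  · exact Or.inl h
  · exact Or.inr h
  · exfalso
    rw [h3] at h9
    obtain ⟨G, hG, g1, g2, g3, g4, g5, g6, g7, g9, g11⟩ := oldWitness96_48a
    exact false_of_oldWitness_ninetySix D G hG (by rw [g1, hL1]; norm_num) (by rw [g2, h2]; norm_num)
      (by rw [g3, h3]; norm_num) (by rw [g4, h4]; norm_num) (by rw [g5, h5]; norm_num) (by rw [g6, h6]; norm_num)
      (by rw [g7, h7]; norm_num) (by rw [g9, h9]; norm_num) (by rw [g11, h11]; norm_num)
  · exfalso
    rw [h3] at h9
    obtain ⟨G, hG, g1, g2, g3, g4, g5, g6, g7, g9, g11⟩ := oldWitness96_24a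
    exact false_of_oldWitness_ninetySix D G hG (by rw [g1, hL1]; norm_num) (by rw [g2, h2]; norm_num)
      (by rw [g3, h3]; norm_num) (by rw [g4, h4]; norm_num) (by rw [g5, h5]; norm_num) (by rw [g6, h6]; norm_num)
      (by rw [g7, h7]; norm_num) (by rw [g9, h9]; norm_num) (by rw [g11, h11]; norm_num)

/-! ## §3 The pinning -/

/-- **`D.f = B₂c + B₃c + B₄c + 2B₅c` (class `96a`) or `D.f = 4B₁c − B₂c + B₃c + B₄c + 2B₅c` (class `96b`)** on the nine-form basis, for every
`X₀(96)`-datum `D` of every elliptic `W/ℚ` — FACT-FREE. [cite: CremonaAlgorithms1997, Table 3 (N = 96)] -/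
theorem f_eq_ninetySix (D : ModularParametrizationData W 96) :
    D.f = ∑ i, (![(0 : ℂ), 1, 1, 1, 2, 0, 0, 0, 0] : Fin 9 → ℂ) i • basis96 i ∨
      D.f = ∑ i, (![(4 : ℂ), -1, 1, 1, 2, 0, 0, 0, 0] : Fin 9 → ℂ) i • basis96 i := by
  obtain ⟨h2, -, -⟩ := curveInputs_ninetySix D
  obtain ⟨h4, h6, h9⟩ := forcedPivots_ninetySix D
  have hL1 : W.LFunction 1 = 1 := W.LFunction_apply_one
  obtain ⟨e0_1, e0_2, e0_3, e0_4, e0_5, e0_6, e0_7, e0_9, e0_11⟩ := cols_B1c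
  obtain ⟨e1_1, e1_2, e1_3, e1_4, e1_5, e1_6, e1_7, e1_9, e1_11⟩ := cols_B2c
  obtain ⟨e2_1, e2_2, e2_3, e2_4, e2_5, e2_6, e2_7, e2_9, e2_11⟩ := cols_B3c
  obtain ⟨e3_1, e3_2, e3_3, e3_4, e3_5, e3_6, e3_7, e3_9, e3_11⟩ := cols_B4c
  obtain ⟨e4_1, e4_2, e4_3, e4_4, e4_5, e4_6, e4_7, e4_9, e4_11⟩ := cols_B5c
  rcases coeffs_eq_ninetySix D with ⟨h3, h5, h7, h11⟩ | ⟨h3, h5, h7, h11⟩ <;> rw [h3] at h9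
  · left
    refine pivotsSeparate_ninetySix _ _ ?_ ?_ ?_ ?_ ?_ ?_ ?_ ?_ ?_ <;>
      rw [cuspCoeff_f96, cuspCoeff_sum_smul96] <;>
      simp only [Fin.sum_univ_succ, Fin.sum_univ_zero, basis96, Matrix.cons_val_zero, Matrix.cons_val_succ,
        e0_1, e0_2, e0_3, e0_4, e0_5, e0_6, e0_7, e0_9, e0_11, e1_1, e1_2, e1_3, e1_4, e1_5, e1_6, e1_7, e1_9, e1_11, e2_1, e2_2, e2_3, e2_4, e2_5, e2_6, e2_7, e2_9, e2_11, e3_1, e3_2, e3_3, e3_4, e3_5, e3_6, e3_7, e3_9, e3_11, e4_1, e4_2, e4_3, e4_4, e4_5, e4_6, e4_7, e4_9, e4_11,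
        hL1, h2, h3, h4, h5, h6, h7, h9, h11] <;>
      norm_num
  · right
    refine pivotsSeparate_ninetySix _ _ ?_ ?_ ?_ ?_ ?_ ?_ ?_ ?_ ?_ <;>
      rw [cuspCoeff_f96, cuspCoeff_sum_smul96] <;>
      simp only [Fin.sum_univ_succ, Fin.sum_univ_zero, basis96, Matrix.cons_val_zero, Matrix.cons_val_succ,
        e0_1, e0_2, e0_3, e0_4, e0_5, e0_6, e0_7, e0_9, e0_11, e1_1, e1_2, e1_3, e1_4, e1_5, e1_6, e1_7, e1_9, e1_11, e2_1, e2_2, e2_3, e2_4, e2_5, e2_6, e2_7, e2_9, e2_11, e3_1, e3_2, e3_3, e3_4, e3_5, e3_6, e3_7, e3_9, e3_11, e4_1, e4_2, e4_3, e4_4, e4_5, e4_6, e4_7, e4_9, e4_11,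
        hL1, h2, h3, h4, h5, h6, h7, h9, h11] <;>
      norm_num

/-- **THE NEWFORM OF EVERY `X₀(96)`-DATUM IS `φ₉₆ₐ` OR `φ₉₆_b`, AS FUNCTIONS ON `ℍ`** — literally the hypothesis `hpin` of p3 g24's
`ManinConstantNinetySix.maninConstant_ninetySix_of_pinning` — FACT-FREE. [cite: CremonaAlgorithms1997, Table 3 (N = 96)] [cite: Koehler2011, §2.1] -/
theorem f_apply_eq_ninetySix (D : ModularParametrizationData W 96) :
    (⇑D.f = fun τ ↦ (etaQuotient 96 (expFn [(4, 2), (8, -3), (12, -4), (16, 1), (24, 11), (48, -3)]) τ + etaQuotient 96 (expFn [(4, 1), (8, -1), (12, -1), (24, 3), (32, 2), (48, 2), (96, -2)]) τ + etaQuotient 96 (expFn [(4, 1), (8, -3), (12, -1), (16, 6), (24, 5), (32, -2), (48, -4), (96, 2)]) τ + 2 * etaQuotient 96 (expFn [(2, 1), (4, -2), (6, -3), (8, 2), (12, 8), (16, -1), (24, -4), (48, 3)]) τ)) ∨ (⇑D.f = fun τ ↦ (4 * etaQuotient 96 (expFn [(4, 1), (12, -1), (16, -1), (24, 2), (48, 3)])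 τ - etaQuotient 96 (expFn [(4, 2), (8, -3), (12, -4), (16, 1), (24, 11), (48, -3)]) τ + etaQuotient 96 (expFn [(4, 1), (8, -1), (12, -1), (24, 3), (32, 2), (48, 2), (96, -2)]) τ + etaQuotient 96 (expFn [(4, 1), (8, -3), (12, -1), (16, 6), (24, 5), (32, -2), (48, -4), (96, 2)]) τ + 2 * etaQuotient 96 (expFn [(2, 1), (4, -2), (6, -3), (8, 2), (12, 8), (16, -1), (24, -4), (48, 3)]) τ)) := by
  rcases f_eq_ninetySix D with h | h
  · left
    rw [h]
    simp only [Fin.sum_univ_succ, Fin.sum_univ_zero, basis96, Matrix.cons_val_zero, Matrix.cons_val_succ, zero_smul, add_zero,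
      zero_add, one_smul]
    funext τ
    simp only [CuspForm.coe_add, Pi.add_apply, CuspForm.IsGLPos.smul_apply, smul_eq_mul, B2c, B3c, B4c, B5c,
      coe_etaQuotientCuspForm, rB2, rB3, rB4, rB5]
    ring
  · right
    rw [h]
    simp only [Fin.sum_univ_succ, Fin.sum_univ_zero, basis96, Matrix.cons_val_zero, Matrix.cons_val_succ, zero_smul, add_zero,
      one_smul]
    funext τ
    simp only [CuspForm.coe_add, Pi.add_apply, CuspForm.IsGLPos.smul_apply, smul_eq_mul, B1c, B2c, B3c, B4c, B5c,
      coe_etaQuotientCuspForm, rB1, rB2, rB3, rB4, rB5]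
    ring

/-! ## §4 LEVEL 96 COMPLETE -/

/-- p3's conditional package `maninConstant_ninetySix_of_pinning` with its pinning hypothesis DISCHARGED: `|c| = 1 ∧ 2 ∤ c ∧ 3 ∤ c` on `X₀(96)`.
[cite: AgasheRibetStein2006, §§1–2] -/
theorem maninConstant_ninetySix (W : WeierstrassCurve ℚ) [W.IsElliptic] [W.IsGloballyMinimal]
    (D : ModularParametrizationData W 96) (hopt : ∀ z ∈ D.L.lattice, ∃ w ∈ periodLattice D.f, z = D.c * w) :
    |D.maninConstant| = 1 ∧ ¬ (2 : ℤ) ∣ D.maninConstant ∧ ¬ (3 : ℤ) ∣ D.maninConstant :=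
  ManinConstantNinetySix.maninConstant_ninetySix_of_pinning (fun _ _ D' ↦ f_apply_eq_ninetySix D') W D hopt

/-- **`|c| = 1` on `X₀(96)`, UNCONDITIONALLY**: for every globally minimal elliptic `W/ℚ` and every `X₀(96)`-parametrisation datum `D` of `W`
with the lattice clause `Λ_W = c·Λ(D.f)`. [cite: AgasheRibetStein2006, §§1–2] -/
theorem abs_maninConstant_eq_one_ninetySix (W : WeierstrassCurve ℚ) [W.IsElliptic] [W.IsGloballyMinimal]
    (D : ModularParametrizationData W 96) (hopt : ∀ z ∈ D.L.lattice, ∃ w ∈ periodLattice D.f, z = D.c * w) :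
    |D.maninConstant| = 1 :=
  (maninConstant_ninetySix W D hopt).1

/-- **`2 ∤ c` on `X₀(96)`, UNCONDITIONALLY** — the body of the crux C2 `ManinOddAtFour` at `N = 96` (`v₂ = 5`) with none of its fact hypotheses.
[cite: AgasheRibetStein2006, §§1–2] -/
theorem not_two_dvd_maninConstant_ninetySix (W : WeierstrassCurve ℚ) [W.IsElliptic] [W.IsGloballyMinimal]
    (D : ModularParametrizationData W 96) (hopt : ∀ z ∈ D.L.lattice, ∃ w ∈ periodLattice D.f, z = D.c * w) :
    ¬ (2 : ℤ) ∣ D.maninConstant :=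
  (maninConstant_ninetySix W D hopt).2.1

/-- `3 ∤ c` on `X₀(96)` (`3 ∥ 96`: the semistable prime, here fact-free as well). [cite: AgasheRibetStein2006, §§1–2] -/
theorem not_three_dvd_maninConstant_ninetySix (W : WeierstrassCurve ℚ) [W.IsElliptic] [W.IsGloballyMinimal]
    (D : ModularParametrizationData W 96) (hopt : ∀ z ∈ D.L.lattice, ∃ w ∈ periodLattice D.f, z = D.c * w) :
    ¬ (3 : ℤ) ∣ D.maninConstant :=
  (maninConstant_ninetySix W D hopt).2.2

/-- **No prime divides `c` on `X₀(96)`.** [cite: AgasheRibetStein2006, §§1–2] -/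
theorem not_prime_dvd_maninConstant_ninetySix (W : WeierstrassCurve ℚ) [W.IsElliptic] [W.IsGloballyMinimal]
    (D : ModularParametrizationData W 96) (hopt : ∀ z ∈ D.L.lattice, ∃ w ∈ periodLattice D.f, z = D.c * w)
    {p : ℕ} (hp : p.Prime) : ¬ (p : ℤ) ∣ D.maninConstant := by
  have h := abs_maninConstant_eq_one_ninetySix W D hopt
  intro hpd
  have h1 := Int.le_of_dvd (by rw [h]; norm_num) ((dvd_abs _ _).mpr hpd)
  rw [h] at h1
  have := hp.two_le
  omega

/-- **The C2 shape `ManinOddAtFour` RESTRICTED TO `N = 96`**, binders verbatim (the four printed-fact hypotheses are accepted and left unused):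
UNCONDITIONAL.  The `∀ N` crux is NOT proved by this. [cite: AgasheRibetStein2006, §§1–2] -/
theorem maninOddAtFour_ninetySix :
    mazur_not_dvd_maninConstant_of_odd → abbesUllmo_not_dvd_maninConstant_of_not_dvd_level →
    cesnavicius_not_two_dvd_maninConstant_of_two_dvd_level → exists_isNewformOf →
    ∀ (W : WeierstrassCurve ℚ) [W.IsElliptic] [W.IsGloballyMinimal] (D : ModularParametrizationData W 96),
      (∀ z ∈ D.L.lattice, ∃ w ∈ periodLattice D.f, z = D.c * w) → 2 ^ 2 ∣ 96 → ¬ (2 : ℤ) ∣ D.maninConstant :=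
  fun _ _ _ _ W _ _ D hopt _ ↦ not_two_dvd_maninConstant_ninetySix W D hopt

end Summit.BirchSwinnertonDyer.BirchSwinnertonDyer.Theorems.ManinLocalTwoThree.LevelNinetySix

end
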